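/-
COR-CM (cell pub-hodgecm2, stage 2 of the Hodge ladder) — junction B01: the PINNED (β)-FREE END DISPLAYS — the pinning lane's supply
junction `Model.faceSupply_of_thm418AsPrinted_pinnedE_isog` (`Transposition/Item6SupplyPinnedAssembly.lean`, pin-1/pin-2/pin-3 under
own-htheta; COORDINATOR RULING «FINISH-TODAY SWARM» 2026-08-21T16:13:55Z (2)) COMPOSED BY NAME with the meeting-form displays of the x2
lane (`CorCM/B01/FaceWedgeOverlapBypassMeeting.lean`, `…OfExhaustionMeeting.lean`; lead NAMING RULING HOME/INBOX l.4194 (3)).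
Authored and filed by seat prover-pub-hodgecm2-b01-x2-g3-0 (b01-x2 gen 3), 2026-08-21 (offer HOME/INBOX 17:39:05Z).  Theorems only
(two one-line compositions, at the records of the universe of record): no `def`, no instance, no cite binder, nothing cited as a record, nothing asserted, no `sorry`; no file of
another lane is modified.
T5 (standing tribunal item, COORDINATOR RULING 2026-08-21T15:33:56Z (3)): the binder sets below (= the T5-checked pin binders of
`Item6SupplyPinnedAssembly.lean` §1 ∪ the T5-checked `hM` ∕ `hEP`) were submitted to pub-hodgecm2-t5-consist-1 on the exact bytes before
filing (HOME/INBOX; verdict line in HOME/T5-LEDGER.md, quoted in the filing note).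
FRAMING (COORDINATOR RULING 2026-08-21T11:55:35Z): HC_CM is NOT proved; nothing below is an «S2 SUPPLY CLOSED» statement; every
displayed hypothesis is OPEN at a general face and inhabited by no one.
-/
import Summits.HodgeConjecture.CorCM.B01.Transposition.Item6SupplyPinnedAssembly
import Summits.HodgeConjecture.CorCM.B01.FaceWedgeOverlapOfExhaustionMeeting
import HarnessLib

/-!
# The pinned end display without `hD`: pin binders + `hM` (or + `hEP`) ⇒ `HC_CM`

The pinning lane's END DISPLAY `Model.hc_cm_of_thm418AsPrinted_pinnedE_isog (U) (hU) … (hD)` composes its supply junction §1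
(`faceSupply_of_thm418AsPrinted_pinnedE_isog … : U.FaceSupply`) with `Model.hc_cm_of_supply_of_dictionary_of_eq _ rfl … hD`, whose
`hD` (`Transposition/Item6HoldsRec.lean`:211–226) binds (β) `emb Γ' (cover^* x) = emb Γ x` — consistent, but FALSE at the tree's only
model embedding `Model.embOf` (b01-idea-2 g19 IDEA-2t; stage-1 hazard C1): no tree construction can inhabit it.  THIS FILE composes the
SAME junction §1 BY NAME with the two (β)-free meeting-form displays of the x2 lane instead:
* `hc_cm_of_thm418AsPrinted_pinnedE_isog_settingMeetSat_rec` — pin binders + `hM` (ONE isolation setting per context over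
  `Lp ℂ 2 V.autMeasure`, C5′ at SATURATED (12)-sets, C6′; `FaceWedgeOverlapBypassMeeting.lean`), at the four `_holds` records +
  `deligneMilne1982_Thm_6_20_full_holds`;
* `hc_cm_of_thm418AsPrinted_pinnedE_isog_exhaustion_pairSettingMeet_rec` — pin binders + `hEP` (line families, (E) exhaustion, one setting
  per wedge-carrying pair with C5′ at PINNED sets and C6′; `FaceWedgeOverlapOfExhaustionMeeting.lean`), likewise.
RESIDUAL BINDERS = EXACTLY the pin binders {`D`, `Aμ₀`, `AK`, `homE`, `hE`, `hLiu`, `hObj`, `hChi`, `hirr`, `hsm`,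
`hμ`, `hCMisogE`, `hComp`} (their classification: pin-1/pin-2/pin-3 lines and the red-team DELTA audits) + `hM` resp. `hEP` (theirs:
`FaceWedgeOverlapBypassMeeting.lean` ∕ `…OfExhaustionMeeting.lean` module docstrings: (v-S)/C6′/pinned C5′ PKG-GENERAL per
configuration, (E) cite-level un-owned, C5′-at-saturation = (E) + TRAP T2).  No `HG/emb/cover`, no (α)(β)(γ), no `levelMeet`, no
`TranslateClosed`; item (iii) = `Model.embOf` + D2; B01-H = `Transposition.Model.heckeWedge10_of_heckeFamily`.
HC_CM is NOT proved: none of these hypotheses is inhabited; count-neutral alternative readings, no row change.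
-/

noncomputable section

set_option autoImplicit false

open scoped TensorProduct InnerProductSpace

namespace Summit.HodgeConjecture.CorCM.Model

open CategoryTheory CategoryTheory.Limits AlgebraicGeometry NumberField MeasureTheory
open Literature.AlgebraicGeometry.Motives
open Literature.AlgebraicGeometry.ShimuraVarieties
open Literature.AlgebraicGeometry.Motives.HodgeStructure (conj)
open Literature.AlgebraicGeometry.HodgeTheory
open Literature.AlgebraicGeometry.ComplexMultiplication (IsCMTypeRealisation)
open Literature.NumberTheory.ComplexMultiplication
open Literature.NumberTheory.Automorphic
open Literature.NumberTheory.Automorphic.IdeleClassGroup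
open Literature.NumberTheory.Automorphic.PicardCM
open Literature.NumberTheory.Automorphic.Liu2021
open Prior.Perl34File (Perl34.IsolationSetting)
open Prior.Perl34File.Perl34

/-! ## §1  Pin binders + `hM` (one setting per context, C5′ at saturated sets) -/

/-- **PINNED END DISPLAY, (β)-FREE, SATURATED MEETING FORM, on the universe OF RECORD** (`exists_isReal_hodgeModel_holds`,
`hodgePQ_independent_of_hodgeModel_holds`, `BallQuotient.ballQuotientUniformised_holds`, `cmAbelianVarietyRealised_holds`,
`deligneMilne1982_Thm_6_20_full_holds` plugged in): the pinning lane's supply junction `faceSupply_of_thm418AsPrinted_pinnedE_isog` (its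
thirteen binders VERBATIM, in its order) composed BY NAME with `hc_cm_of_supply_of_settingMeetSat_embOf`
(`FaceWedgeOverlapBypassMeeting.lean`; binder `hM` VERBATIM at `U_rec`).  Displayed hypotheses = EXACTLY the thirteen pin binders + `hM`;
compare `hc_cm_of_thm418AsPrinted_pinnedE_isog _ rfl … hD`: no `HG/emb/cover`, no (α)(β)(γ).  HC_CM is NOT proved: none is inhabited.
[folklore] -/
theorem hc_cm_of_thm418AsPrinted_pinnedE_isog_settingMeetSat_rec
    (D : ∀ (F : CMField) (ι₁ : F →+* ℂ) (_ : HermSpace3 F ι₁) (_ : CMType F), Thm418Data (maximalRealSubfield F) F)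
    (Aμ₀ : ∀ (F : CMField) (ι₁ : F →+* ℂ) (V : HermSpace3 F ι₁) (Φ : CMType F), (D F ι₁ V Φ).Obj → AbelianVariety F)
    (AK : ∀ (F : CMField) (ι₁ : F →+* ℂ) (V : HermSpace3 F ι₁) (Φ : CMType F), Subgroup (D F ι₁ V Φ).G → AbelianVariety F)
    (homE : ∀ (F : CMField) (ι₁ : F →+* ℂ) (V : HermSpace3 F ι₁) (Φ : CMType F) (K : Subgroup (D F ι₁ V Φ).G)
      (Dμ : (D F ι₁ V Φ).Obj), (D F ι₁ V Φ).HomK K Dμ →+ ℚ ⊗[ℤ] (AK F ι₁ V Φ K ⟶ Aμ₀ F ι₁ V Φ Dμ))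
    (hE : ∀ (F : CMField) (ι₁ : F →+* ℂ) (V : HermSpace3 F ι₁) (Φ : CMType F) (K : Subgroup (D F ι₁ V Φ).G)
      (Dμ : (D F ι₁ V Φ).Obj), Function.Injective (homE F ι₁ V Φ K Dμ))
    (hLiu : ∀ (F : CMField), IsGalois ℚ F → 6 ≤ Module.finrank ℚ F → ∀ (Φ : CMType F) (ι₁ : F →+* ℂ), ι₁ ∈ Φ.1 →
      ∀ V : HermSpace3 F ι₁, Thm418AsPrinted (D F ι₁ V Φ))
    (hObj : ∀ (F : CMField), IsGalois ℚ F → 6 ≤ Module.finrank ℚ F → ∀ (Φ : CMType F) (ι₁ : F →+* ℂ), ι₁ ∈ Φ.1 →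
      ∀ V : HermSpace3 F ι₁, Nonempty (D F ι₁ V Φ).Obj)
    (hChi : ∀ (F : CMField), IsGalois ℚ F → 6 ≤ Module.finrank ℚ F → ∀ (Φ : CMType F) (ι₁ : F →+* ℂ), ι₁ ∈ Φ.1 →
      ∀ V : HermSpace3 F ι₁, Nonempty (D F ι₁ V Φ).Chi)
    (hirr : ∀ (F : CMField), IsGalois ℚ F → 6 ≤ Module.finrank ℚ F → ∀ (Φ : CMType F) (ι₁ : F →+* ℂ), ι₁ ∈ Φ.1 →
      ∀ (V : HermSpace3 F ι₁) (i : (D F ι₁ V Φ).AdmIndex), ((D F ι₁ V Φ).rhoAt i).IsIrreducible)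
    (hsm : ∀ (F : CMField), IsGalois ℚ F → 6 ≤ Module.finrank ℚ F → ∀ (Φ : CMType F) (ι₁ : F →+* ℂ), ι₁ ∈ Φ.1 →
      ∀ (V : HermSpace3 F ι₁) (i : (D F ι₁ V Φ).AdmIndex) (v : (D F ι₁ V Φ).omegaAt i),
        ∃ S : Subgroup (D F ι₁ V Φ).G, IsOpen (S : Set (D F ι₁ V Φ).G) ∧ ∀ k ∈ S, (D F ι₁ V Φ).rhoAt i k v = v)
    (hμ : ∀ (F : CMField), IsGalois ℚ F → 6 ≤ Module.finrank ℚ F → ∀ (Φ : CMType F) (ι₁ : F →+* ℂ), ι₁ ∈ Φ.1 →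
      ∀ (V : HermSpace3 F ι₁) (g : F ≃ₐ[ℚ] F),
        ι₁.comp (g : F →+* F) ∈ (D F ι₁ V Φ).cmType.1 ↔ ι₁.comp (g.symm : F →+* F) ∈ Φ.1)
    (hCMisogE : ∀ (F : CMField) [IsGalois ℚ F], 6 ≤ Module.finrank ℚ F → ∀ (Φ : CMType F) (ι₁ : F →+* ℂ), ι₁ ∈ Φ.1 →
      ∀ (V : HermSpace3 F ι₁) (Dμ : (D F ι₁ V Φ).Obj),
        haveI := (D F ι₁ V Φ).isConjugateSymplectic.numberField_muAlgValueField
        ∀ e : reflexField ℚ F (algValuedIn ι₁ (D F ι₁ V Φ).cmType.1) →+* muAlgValueField F (D F ι₁ V Φ).μ,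
          (∀ k : reflexField ℚ F (algValuedIn ι₁ (D F ι₁ V Φ).cmType.1),
            ((e k : muAlgValueField F (D F ι₁ V Φ).μ) : ℂ) = ι₁ k) →
          ∃ (B : AbelianVariety ℂ) (g : (letI := ι₁.toAlgebra; (Aμ₀ F ι₁ V Φ Dμ).baseChange ℂ) ⟶ B), AbelianVariety.IsIsogeny g ∧
            ∃ (ιB : 𝓞 (muAlgValueField F (D F ι₁ V Φ).μ) →+* End B)
              (θB : muAlgValueField F (D F ι₁ V Φ).μ →+* Module.End ℂ (complexBetti B.X 1)),
              IsCMTypeRealisation (inducedCMType e (reflexCMType ι₁ (D F ι₁ V Φ).cmType (AlgHom.id ℚ F))) B ιB θB)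
    (hComp : ∀ (F : CMField), IsGalois ℚ F → 6 ≤ Module.finrank ℚ F → ∀ (Φ : CMType F) (ι₁ : F →+* ℂ), ι₁ ∈ Φ.1 →
      ∀ V : HermSpace3 F ι₁, ∃ Ksm : Subgroup (D F ι₁ V Φ).G, IsOpenCompact Ksm ∧
        ∀ K : Subgroup (D F ι₁ V Φ).G, IsOpenCompact K → K ≤ Ksm →
          ∃ (C : Type) (_ : Fintype C) (X : C → SchemeOver ℂ) (B : ∀ c, UnitaryBallUniformisationDatum 2 (X c))
            (Γ : C → Level V) (𝒥 : ∀ c, Jacobian (X c))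
            (π : ∀ c, (letI := ι₁.toAlgebra; (AK F ι₁ V Φ K).baseChange ℂ) ⟶ (𝒥 c).J),
            (∀ c, (B c).Hℂ = V.Hm.map ι₁) ∧
            (∀ c, (B c).Γ.map (Matrix.GeneralLinearGroup.map (B c).τ₁) =
              (Γ c).Γ.map (Matrix.GeneralLinearGroup.map ι₁)) ∧
            Nonempty (IsLimit (Fan.mk (letI := ι₁.toAlgebra; (AK F ι₁ V Φ K).baseChange ℂ) π))) :
    let U := picardCMUniverse exists_isReal_hodgeModel_holds hodgePQ_independent_of_hodgeModel_holds
      BallQuotient.ballQuotientUniformised_holds cmAbelianVarietyRealised_holds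
    let hU := ballQuotientUniformisedDatum_of BallQuotient.ballQuotientUniformised_holds
    (∀ (F : CMField), IsGalois ℚ F → 6 ≤ Module.finrank ℚ F → ∀ (f : Face F) (ι₁ : F →+* ℂ), f.Admissible ι₁ →
      ∀ V : HermSpace3 F ι₁,
      ∃ (H CG G SK SigIdx SigIdxG : Type) (_ : NormedAddCommGroup H) (_ : InnerProductSpace ℂ H) (_ : CompleteSpace H)
        (_ : NormedAddCommGroup CG) (_ : NormedSpace ℂ CG) (_ : Group G) (_ : TopologicalSpace G) (_ : TopologicalSpace SK)
        (S : Perl34.IsolationSetting H (Lp ℂ 2 V.autMeasure) CG G SK SigIdx SigIdxG),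
        (∀ (Γ : Level V) (ω₁ ω₂ : U.CohC (U.pms F ι₁ V Γ) 1),
          ω₁ ∈ U.Uiso Γ F (f.psi 0) ι₁ → ω₂ ∈ U.Uiso Γ F (f.psi 1) ι₁ →
            embOf exists_isReal_hodgeModel_holds hodgePQ_independent_of_hodgeModel_holds hU cmAbelianVarietyRealised_holds Γ
                (U.cup2C (U.pms F ι₁ V Γ) 1 ω₁ ω₂) ≠ 0 →
              ∃ u ∈ S.t12.S12,
                ⟪embOf exists_isReal_hodgeModel_holds hodgePQ_independent_of_hodgeModel_holds hU cmAbelianVarietyRealised_holds Γ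
                    (U.cup2C (U.pms F ι₁ V Γ) 1 ω₁ ω₂), u⟫_ℂ ≠ 0) ∧
        (∀ χ : S.t34.X, S.t34.allowed χ → ∀ (Φ : SK) (Γ₁ : Level V)
          (ω₁ ω₂ : U.CohC (U.pms F ι₁ V Γ₁) 1),
          ω₁ ∈ U.Uiso Γ₁ F (f.psi 0) ι₁ →
          ω₂ ∈ U.Uiso Γ₁ F (f.psi 1) ι₁ →
            ⟪embOf exists_isReal_hodgeModel_holds hodgePQ_independent_of_hodgeModel_holds hU cmAbelianVarietyRealised_holds Γ₁
                (U.cup2C (U.pms F ι₁ V Γ₁) 1 ω₁ ω₂),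
              S.t34.ϑ χ Φ⟫_ℂ ≠ 0 →
              ∃ (Γ : Level V) (ω : Fin 4 → U.CohC (U.pms F ι₁ V Γ) 1),
                (∀ i, ω i ∈ U.Uiso Γ F (f.psi i) ι₁) ∧
                  ⟪embOf exists_isReal_hodgeModel_holds hodgePQ_independent_of_hodgeModel_holds hU cmAbelianVarietyRealised_holds Γ
                      (U.cup2C (U.pms F ι₁ V Γ) 1 (ω 2) (ω 3)),
                    embOf exists_isReal_hodgeModel_holds hodgePQ_independent_of_hodgeModel_holds hU cmAbelianVarietyRealised_holds Γ
                      (U.cup2C (U.pms F ι₁ V Γ) 1 (ω 0) (ω 1))⟫_ℂ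
                    ≠ 0)) →
    HC_CM :=
  fun hM ↦ hc_cm_of_supply_of_settingMeetSat_embOf exists_isReal_hodgeModel_holds hodgePQ_independent_of_hodgeModel_holds
    BallQuotient.ballQuotientUniformised_holds cmAbelianVarietyRealised_holds deligneMilne1982_Thm_6_20_full_holds
    (faceSupply_of_thm418AsPrinted_pinnedE_isog _ _ _ _ D Aμ₀ AK homE hE hLiu hObj hChi hirr hsm hμ hCMisogE hComp) hM

/-! ## §2  Pin binders + `hEP` (line families, exhaustion, one setting per wedge-carrying pair, C5′ at pinned sets) -/

/-- **PINNED END DISPLAY, (β)-FREE, PER-PAIR ∕ EXHAUSTION MEETING FORM, on the universe OF RECORD**: the same junction composed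
BY NAME with `hc_cm_of_supply_of_exhaustion_pairSettingMeet_embOf` (`FaceWedgeOverlapOfExhaustionMeeting.lean`; binder `hEP` VERBATIM at
`U_rec`).  Displayed hypotheses = EXACTLY the thirteen pin binders + `hEP`.  HC_CM is NOT proved: none is inhabited. [folklore] -/
theorem hc_cm_of_thm418AsPrinted_pinnedE_isog_exhaustion_pairSettingMeet_rec
    (D : ∀ (F : CMField) (ι₁ : F →+* ℂ) (_ : HermSpace3 F ι₁) (_ : CMType F), Thm418Data (maximalRealSubfield F) F)
    (Aμ₀ : ∀ (F : CMField) (ι₁ : F →+* ℂ) (V : HermSpace3 F ι₁) (Φ : CMType F), (D F ι₁ V Φ).Obj → AbelianVariety F)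
    (AK : ∀ (F : CMField) (ι₁ : F →+* ℂ) (V : HermSpace3 F ι₁) (Φ : CMType F), Subgroup (D F ι₁ V Φ).G → AbelianVariety F)
    (homE : ∀ (F : CMField) (ι₁ : F →+* ℂ) (V : HermSpace3 F ι₁) (Φ : CMType F) (K : Subgroup (D F ι₁ V Φ).G)
      (Dμ : (D F ι₁ V Φ).Obj), (D F ι₁ V Φ).HomK K Dμ →+ ℚ ⊗[ℤ] (AK F ι₁ V Φ K ⟶ Aμ₀ F ι₁ V Φ Dμ))
    (hE : ∀ (F : CMField) (ι₁ : F →+* ℂ) (V : HermSpace3 F ι₁) (Φ : CMType F) (K : Subgroup (D F ι₁ V Φ).G)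
      (Dμ : (D F ι₁ V Φ).Obj), Function.Injective (homE F ι₁ V Φ K Dμ))
    (hLiu : ∀ (F : CMField), IsGalois ℚ F → 6 ≤ Module.finrank ℚ F → ∀ (Φ : CMType F) (ι₁ : F →+* ℂ), ι₁ ∈ Φ.1 →
      ∀ V : HermSpace3 F ι₁, Thm418AsPrinted (D F ι₁ V Φ))
    (hObj : ∀ (F : CMField), IsGalois ℚ F → 6 ≤ Module.finrank ℚ F → ∀ (Φ : CMType F) (ι₁ : F →+* ℂ), ι₁ ∈ Φ.1 →
      ∀ V : HermSpace3 F ι₁, Nonempty (D F ι₁ V Φ).Obj)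
    (hChi : ∀ (F : CMField), IsGalois ℚ F → 6 ≤ Module.finrank ℚ F → ∀ (Φ : CMType F) (ι₁ : F →+* ℂ), ι₁ ∈ Φ.1 →
      ∀ V : HermSpace3 F ι₁, Nonempty (D F ι₁ V Φ).Chi)
    (hirr : ∀ (F : CMField), IsGalois ℚ F → 6 ≤ Module.finrank ℚ F → ∀ (Φ : CMType F) (ι₁ : F →+* ℂ), ι₁ ∈ Φ.1 →
      ∀ (V : HermSpace3 F ι₁) (i : (D F ι₁ V Φ).AdmIndex), ((D F ι₁ V Φ).rhoAt i).IsIrreducible)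
    (hsm : ∀ (F : CMField), IsGalois ℚ F → 6 ≤ Module.finrank ℚ F → ∀ (Φ : CMType F) (ι₁ : F →+* ℂ), ι₁ ∈ Φ.1 →
      ∀ (V : HermSpace3 F ι₁) (i : (D F ι₁ V Φ).AdmIndex) (v : (D F ι₁ V Φ).omegaAt i),
        ∃ S : Subgroup (D F ι₁ V Φ).G, IsOpen (S : Set (D F ι₁ V Φ).G) ∧ ∀ k ∈ S, (D F ι₁ V Φ).rhoAt i k v = v)
    (hμ : ∀ (F : CMField), IsGalois ℚ F → 6 ≤ Module.finrank ℚ F → ∀ (Φ : CMType F) (ι₁ : F →+* ℂ), ι₁ ∈ Φ.1 →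
      ∀ (V : HermSpace3 F ι₁) (g : F ≃ₐ[ℚ] F),
        ι₁.comp (g : F →+* F) ∈ (D F ι₁ V Φ).cmType.1 ↔ ι₁.comp (g.symm : F →+* F) ∈ Φ.1)
    (hCMisogE : ∀ (F : CMField) [IsGalois ℚ F], 6 ≤ Module.finrank ℚ F → ∀ (Φ : CMType F) (ι₁ : F →+* ℂ), ι₁ ∈ Φ.1 →
      ∀ (V : HermSpace3 F ι₁) (Dμ : (D F ι₁ V Φ).Obj),
        haveI := (D F ι₁ V Φ).isConjugateSymplectic.numberField_muAlgValueField
        ∀ e : reflexField ℚ F (algValuedIn ι₁ (D F ι₁ V Φ).cmType.1) →+* muAlgValueField F (D F ι₁ V Φ).μ,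
          (∀ k : reflexField ℚ F (algValuedIn ι₁ (D F ι₁ V Φ).cmType.1),
            ((e k : muAlgValueField F (D F ι₁ V Φ).μ) : ℂ) = ι₁ k) →
          ∃ (B : AbelianVariety ℂ) (g : (letI := ι₁.toAlgebra; (Aμ₀ F ι₁ V Φ Dμ).baseChange ℂ) ⟶ B), AbelianVariety.IsIsogeny g ∧
            ∃ (ιB : 𝓞 (muAlgValueField F (D F ι₁ V Φ).μ) →+* End B)
              (θB : muAlgValueField F (D F ι₁ V Φ).μ →+* Module.End ℂ (complexBetti B.X 1)),
              IsCMTypeRealisation (inducedCMType e (reflexCMType ι₁ (D F ι₁ V Φ).cmType (AlgHom.id ℚ F))) B ιB θB)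
    (hComp : ∀ (F : CMField), IsGalois ℚ F → 6 ≤ Module.finrank ℚ F → ∀ (Φ : CMType F) (ι₁ : F →+* ℂ), ι₁ ∈ Φ.1 →
      ∀ V : HermSpace3 F ι₁, ∃ Ksm : Subgroup (D F ι₁ V Φ).G, IsOpenCompact Ksm ∧
        ∀ K : Subgroup (D F ι₁ V Φ).G, IsOpenCompact K → K ≤ Ksm →
          ∃ (C : Type) (_ : Fintype C) (X : C → SchemeOver ℂ) (B : ∀ c, UnitaryBallUniformisationDatum 2 (X c))
            (Γ : C → Level V) (𝒥 : ∀ c, Jacobian (X c))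
            (π : ∀ c, (letI := ι₁.toAlgebra; (AK F ι₁ V Φ K).baseChange ℂ) ⟶ (𝒥 c).J),
            (∀ c, (B c).Hℂ = V.Hm.map ι₁) ∧
            (∀ c, (B c).Γ.map (Matrix.GeneralLinearGroup.map (B c).τ₁) =
              (Γ c).Γ.map (Matrix.GeneralLinearGroup.map ι₁)) ∧
            Nonempty (IsLimit (Fan.mk (letI := ι₁.toAlgebra; (AK F ι₁ V Φ K).baseChange ℂ) π))) :
    let U := picardCMUniverse exists_isReal_hodgeModel_holds hodgePQ_independent_of_hodgeModel_holds
      BallQuotient.ballQuotientUniformised_holds cmAbelianVarietyRealised_holds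
    let hU := ballQuotientUniformisedDatum_of BallQuotient.ballQuotientUniformised_holds
    (∀ (F : CMField), IsGalois ℚ F → 6 ≤ Module.finrank ℚ F → ∀ (f : Face F) (ι₁ : F →+* ℂ), f.Admissible ι₁ →
      ∀ V : HermSpace3 F ι₁,
      ∃ (A B : Type) (Θ₀ : A → ∀ Γ : Level V, Set (U.CohC (U.pms F ι₁ V Γ) 1))
        (Θ₁ : B → ∀ Γ : Level V, Set (U.CohC (U.pms F ι₁ V Γ) 1)),
        (∀ (a : A) (Γ : Level V), Θ₀ a Γ ⊆ U.Uiso Γ F (f.psi 0) ι₁) ∧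
        (∀ (b : B) (Γ : Level V), Θ₁ b Γ ⊆ U.Uiso Γ F (f.psi 1) ι₁) ∧
        (∀ Γ : Level V, U.Uiso Γ F (f.psi 0) ι₁ ≤ Submodule.span ℂ (⋃ a, Θ₀ a Γ)) ∧
        (∀ Γ : Level V, U.Uiso Γ F (f.psi 1) ι₁ ≤ Submodule.span ℂ (⋃ b, Θ₁ b Γ)) ∧
        ∀ (a : A) (b : B),
          (∃ (Γ : Level V), ∃ θ ∈ Θ₀ a Γ, ∃ θ' ∈ Θ₁ b Γ, U.cup2C (U.pms F ι₁ V Γ) 1 θ θ' ≠ 0) →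
          ∃ (H CG G SK SigIdx SigIdxG : Type) (_ : NormedAddCommGroup H) (_ : InnerProductSpace ℂ H) (_ : CompleteSpace H)
            (_ : NormedAddCommGroup CG) (_ : NormedSpace ℂ CG) (_ : Group G) (_ : TopologicalSpace G) (_ : TopologicalSpace SK)
            (S : Perl34.IsolationSetting H (Lp ℂ 2 V.autMeasure) CG G SK SigIdx SigIdxG),
            (∀ (Γ : Level V) (ω₁ ω₂ : U.CohC (U.pms F ι₁ V Γ) 1), ω₁ ∈ Θ₀ a Γ → ω₂ ∈ Θ₁ b Γ →
                embOf exists_isReal_hodgeModel_holds hodgePQ_independent_of_hodgeModel_holds hU cmAbelianVarietyRealised_holds Γ (U.cup2C (U.pms F ι₁ V Γ) 1 ω₁ ω₂) ≠ 0 →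
                  ∃ u ∈ S.t12.S12, ⟪embOf exists_isReal_hodgeModel_holds hodgePQ_independent_of_hodgeModel_holds hU cmAbelianVarietyRealised_holds Γ (U.cup2C (U.pms F ι₁ V Γ) 1 ω₁ ω₂), u⟫_ℂ ≠ 0) ∧
            (∀ χ : S.t34.X, S.t34.allowed χ → ∀ (Φ : SK) (Γ₁ : Level V)
              (ω₁ ω₂ : U.CohC (U.pms F ι₁ V Γ₁) 1),
              ω₁ ∈ U.Uiso Γ₁ F (f.psi 0) ι₁ →
              ω₂ ∈ U.Uiso Γ₁ F (f.psi 1) ι₁ →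
                ⟪embOf exists_isReal_hodgeModel_holds hodgePQ_independent_of_hodgeModel_holds hU cmAbelianVarietyRealised_holds Γ₁
                    (U.cup2C (U.pms F ι₁ V Γ₁) 1 ω₁ ω₂),
                  S.t34.ϑ χ Φ⟫_ℂ ≠ 0 →
                  ∃ (Γ : Level V) (ω : Fin 4 → U.CohC (U.pms F ι₁ V Γ) 1),
                    (∀ i, ω i ∈ U.Uiso Γ F (f.psi i) ι₁) ∧
                      ⟪embOf exists_isReal_hodgeModel_holds hodgePQ_independent_of_hodgeModel_holds hU cmAbelianVarietyRealised_holds Γ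
                          (U.cup2C (U.pms F ι₁ V Γ) 1 (ω 2) (ω 3)),
                        embOf exists_isReal_hodgeModel_holds hodgePQ_independent_of_hodgeModel_holds hU cmAbelianVarietyRealised_holds Γ
                          (U.cup2C (U.pms F ι₁ V Γ) 1 (ω 0) (ω 1))⟫_ℂ
                        ≠ 0)) →
    HC_CM :=
  fun hEP ↦ hc_cm_of_supply_of_exhaustion_pairSettingMeet_embOf exists_isReal_hodgeModel_holds hodgePQ_independent_of_hodgeModel_holds
    BallQuotient.ballQuotientUniformised_holds cmAbelianVarietyRealised_holds deligneMilne1982_Thm_6_20_full_holds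
    (faceSupply_of_thm418AsPrinted_pinnedE_isog _ _ _ _ D Aμ₀ AK homE hE hLiu hObj hChi hirr hsm hμ hCMisogE hComp) hEP

#print axioms hc_cm_of_thm418AsPrinted_pinnedE_isog_settingMeetSat_rec
#print axioms hc_cm_of_thm418AsPrinted_pinnedE_isog_exhaustion_pairSettingMeet_rec

end Summit.HodgeConjecture.CorCM.Model

end
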